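import Literature.NumberTheory.NumberFields.GaloisConjugatePrimeProductShape
import Literature.NumberTheory.NumberFields.RelNormGaloisProduct
import Mathlib.NumberTheory.NumberField.CMField
import HarnessLib

/-!
# The Frobenius shape of the CM-type product of a prime (`F ∕ ℚ` Galois): the six clauses of `frob₀_twist`

Topic `NumberTheory/ComplexMultiplication`; namespace `Literature.NumberTheory.ComplexMultiplication`.  Theorems only (no definition, no instance, no
notation, no named fact, no `sorry`).  Cell `hodgecm-mathlib` (D-0151), P6 «MOD programme» (crux hLiu418, `--supports`), sub-desk P6a, organ (C2-arith)
«FROBENIUS SHAPE OF THE TWIST IDEAL» (desk F0P6a-plan (g1) Defs v0.4c field `frob₀_twist` :638–:647; A-p03 (g29)), FILE B = number-field assembly over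
FILE A (★ `NumberFields/GaloisConjugatePrimeProductShape`) and ★ `NumberFields/RelNormGaloisProduct` (Neukirch III (1.6)(iv)).  HC_CM is proved only
modulo the printed citations until rung 0 closes; nothing here is about HC.

THE MATHEMATICS ([NeukirchANT1999] Ch. III §1 (1.6) Prop. (iv); [Shimura1998] §13.1 Thm. 1 and (7); [SerreTate1968] §7 Thm. 11, Cor. 2).  Let `F ∕ ℚ` be
Galois with group `G = F ≃ₐ[ℚ] F` acting on the finite places (★ `GaloisActionPlaces`), `w` a finite place with prime `𝔭_w` and residue cardinality
`q = N 𝔭_w`.  (§1) `∏_{g ∈ G} 𝔭_{g•w} = (q)` as ideals of `𝓞 F` (★ Neukirch at base `ℚ`, plus «every ideal of `𝓞 ℚ ≅ ℤ` is generated by its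
absolute norm»).  (§2) For a CM field `F`, complex conjugation `c` acts on places through EITHER of its two costumes (`F ≃ₐ[F⁺] F`, the record՚s
`(IsCMField.complexConj F) • w`, or its restriction of scalars in `G`) with the same result.  (§3) THE HEAD: if `Ψ ⊆ G` contains the stabiliser of `w`
(«matching condition» `Ψ ⊇ D_w`) and is disjoint from `cΨ` (half of «`Ψ` is a CM type»), then the CM-type product `𝔞 := ∏_{g ∈ Ψ} 𝔭_{g•w}`
has the FROBENIUS SHAPE required by `frob₀_twist`: `𝔞 = 𝔭_w^d · 𝔟` with `𝔟` coprime to `𝔭_w` AND to `𝔭_{c•w}`, `d = #Stab_G(w) = e_w f_w` is EXACTLY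
the exponent of `𝔭_w` in `(q)`, and `q ∈ 𝔞` (since `(q) = ∏_{g ∈ G} 𝔭_{g•w} ⊆ 𝔞`).  For `F` Galois the CM-type product is the classical prime
decomposition of the type norm `N_{Φ′}(N_{F∕K*} 𝔭_w)` ([Shimura1998] §13.1 (7)); the instantiation `twistIdeal γ_σ := ∏_{g ∈ Φ̄_w} 𝔭_{g•w}` of the
datum՚s twist ideal at a Frobenius `σ` therefore satisfies `frob₀_twist` by this file alone (the identification with the Serre twist of the frame
`A₀` is the CM input of the (TW) covers, not of this field).

MAIN STATEMENTS.  §1 `Rat.ringOfIntegers_ideal_eq_span_absNorm`, **`prod_univ_smul_asIdeal_eq_span_absNorm`**; §2 `restrictScalars_complexConj_smul_eq`;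
§3 **`exists_frobeniusShape_prod_smul_asIdeal`** (the six clauses, `c` in `G`-costume) and **`exists_frobeniusShape_prod_smul_asIdeal_complexConj`**
(the record՚s costume `(IsCMField.complexConj F) • w`).

## References
* [NeukirchANT1999] J. Neukirch, *Algebraic Number Theory*, Grundlehren 322 (1999), Ch. III §1 (1.6) Prop. (iv).
* [Shimura1998] G. Shimura, *Abelian Varieties with Complex Multiplication and Modular Functions* (1998), §13.1 Theorem 1 and formula (7).
* [SerreTate1968] J.-P. Serre, J. Tate, *Good reduction of abelian varieties*, Ann. of Math. 88 (1968), §7 Thm. 11 and Cor. 2 (the Frobenius element of a CM abelian variety as an ideal).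
-/

set_option autoImplicit false

open IsDedekindDomain NumberField
open scoped Pointwise

namespace Literature.NumberTheory.ComplexMultiplication

open Literature.NumberTheory.Automorphic Literature.NumberTheory.NumberFields

/-! ### §1 `∏_{g ∈ Gal(F∕ℚ)} 𝔭_{g•w} = (N 𝔭_w)` -/

/-- Every ideal of `𝓞 ℚ` is generated by its absolute norm (transport of Mathlib `Int.ideal_span_absNorm_eq_self` along `𝓞 ℚ ≃ ℤ`).
[cite: NeukirchANT1999, Ch. III §1 (1.6) Prop. (iv)] -/
theorem Rat.ringOfIntegers_ideal_eq_span_absNorm (J : Ideal (𝓞 ℚ)) : J = Ideal.span {((Ideal.absNorm J : ℕ) : 𝓞 ℚ)} := by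
  set e : 𝓞 ℚ ≃+* ℤ := Rat.ringOfIntegersEquiv with he
  -- the norm is invariant under the ring isomorphism (same quotient cardinality)
  have hn : Ideal.absNorm (J.map (e : 𝓞 ℚ →+* ℤ)) = Ideal.absNorm J := by
    rw [Ideal.absNorm_apply, Ideal.absNorm_apply, Submodule.cardQuot_apply, Submodule.cardQuot_apply]
    exact (Nat.card_congr (Ideal.quotientEquiv J (J.map (e : 𝓞 ℚ →+* ℤ)) e rfl).toEquiv).symm
  have h1 : Ideal.span {((Ideal.absNorm J : ℕ) : ℤ)} = J.map (e : 𝓞 ℚ →+* ℤ) := by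
    rw [← hn]; exact Int.ideal_span_absNorm_eq_self _
  have h2 : J = (J.map (e : 𝓞 ℚ →+* ℤ)).map (e.symm : ℤ →+* 𝓞 ℚ) := by
    rw [Ideal.map_map, (by ext x; simp : (e.symm : ℤ →+* 𝓞 ℚ).comp (e : 𝓞 ℚ →+* ℤ) = RingHom.id _), Ideal.map_id]
  conv_lhs => rw [h2, ← h1, Ideal.map_span, Set.image_singleton, map_natCast]

variable {F : Type*} [Field F] [NumberField F]

/-- **`∏_{g ∈ Gal(F∕ℚ)} 𝔭_{g•w} = (N 𝔭_w)·𝓞_F`** for `F ∕ ℚ` Galois (★ Neukirch III (1.6)(iv) at base `ℚ`: the product is `N_{F|ℚ}(𝔭_w)𝓞_F`, and the ideal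
`N_{F|ℚ}(𝔭_w) ⊆ 𝓞 ℚ` is generated by its absolute norm `= N 𝔭_w` by Mathlib `Ideal.absNorm_relNorm`). [cite: NeukirchANT1999, Ch. III §1 (1.6) Prop. (iv)] -/
theorem prod_univ_smul_asIdeal_eq_span_absNorm [IsGalois ℚ F] (w : HeightOneSpectrum (𝓞 F)) :
    ∏ g : (F ≃ₐ[ℚ] F), (g • w).asIdeal = Ideal.span {((Ideal.absNorm w.asIdeal : ℕ) : 𝓞 F)} := by
  haveI := w.isMaximal
  have h := NumberField.prod_smul_eq_map_relNorm_of_isMaximal ℚ F w.asIdeal w.ne_bot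
  simp only [HeightOneSpectrum.smul_asIdeal]
  rw [h, Rat.ringOfIntegers_ideal_eq_span_absNorm (Ideal.relNorm (𝓞 ℚ) w.asIdeal), Ideal.map_span, Set.image_singleton, map_natCast,
    Ideal.absNorm_relNorm]

/-! ### §2 Complex conjugation on places: the two costumes agree -/

/-- For a CM field `F ∕ ℚ`, the record՚s place `(IsCMField.complexConj F) • w` (action of `F ≃ₐ[F⁺] F`) is the place `c̃ • w` for the element
`c̃ := (IsCMField.complexConj F).restrictScalars ℚ` of `F ≃ₐ[ℚ] F` (both act on `𝓞 F` by the same ring automorphism). [cite: Shimura1998, §13.1] -/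
theorem restrictScalars_complexConj_smul_eq [IsCMField F] (w : HeightOneSpectrum (𝓞 F)) :
    ((IsCMField.complexConj F).restrictScalars ℚ) • w = (IsCMField.complexConj F) • w := by
  apply HeightOneSpectrum.ext
  rw [HeightOneSpectrum.smul_asIdeal, HeightOneSpectrum.smul_asIdeal, Ideal.pointwise_smul_def, Ideal.pointwise_smul_def]
  congr 1

/-! ### §3 THE HEAD: the six clauses of `frob₀_twist` for the CM-type product of a prime -/

/-- **FROBENIUS SHAPE OF THE CM-TYPE PRODUCT OF A PRIME** (`F ∕ ℚ` Galois; `c ∈ Gal(F∕ℚ)`; `Ψ ⊆ Gal(F∕ℚ)` with the MATCHING CONDITION `Stab(w) ⊆ Ψ`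
and the half-CM-type condition `Ψ ∩ cΨ = ∅`): with `𝔞 := ∏_{g ∈ Ψ} 𝔭_{g•w}` and `d := #Stab(w)`, there is `𝔟` with `𝔟 + 𝔭_w = (1)`, `𝔟 + 𝔭_{c•w} = (1)`,
`𝔞 = 𝔭_w^d · 𝔟`, `𝔭_w^d ∣ (N 𝔭_w)`, `𝔭_w^{d+1} ∤ (N 𝔭_w)`, `N 𝔭_w ∈ 𝔞` — the clauses of `frob₀_twist` (Defs `F0_P6a_ModuliDatumDefs` v0.4c :643–:647) for
`twistIdeal γ_σ := 𝔞`. [cite: Shimura1998, §13.1 Theorem 1 and (7)] [cite: SerreTate1968, §7 Thm. 11 and Cor. 2] [cite: NeukirchANT1999, Ch. III §1 (1.6) Prop. (iv)] -/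
theorem exists_frobeniusShape_prod_smul_asIdeal [IsGalois ℚ F] [DecidableEq (HeightOneSpectrum (𝓞 F))] (Ψ : Finset (F ≃ₐ[ℚ] F))
    (w : HeightOneSpectrum (𝓞 F)) (c : F ≃ₐ[ℚ] F) (hD : ∀ g : F ≃ₐ[ℚ] F, g • w = w → g ∈ Ψ) (hc : ∀ g ∈ Ψ, c * g ∉ Ψ) :
    ∃ 𝔟 : Ideal (𝓞 F),
      𝔟 ⊔ w.asIdeal = ⊤ ∧ 𝔟 ⊔ (c • w).asIdeal = ⊤ ∧
      ∏ g ∈ Ψ, (g • w).asIdeal = w.asIdeal ^ (Finset.univ.filter (fun g : F ≃ₐ[ℚ] F => g • w = w)).card * 𝔟 ∧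
      w.asIdeal ^ (Finset.univ.filter (fun g : F ≃ₐ[ℚ] F => g • w = w)).card ∣ Ideal.span {((Ideal.absNorm w.asIdeal : ℕ) : 𝓞 F)} ∧
      ¬ w.asIdeal ^ ((Finset.univ.filter (fun g : F ≃ₐ[ℚ] F => g • w = w)).card + 1) ∣ Ideal.span {((Ideal.absNorm w.asIdeal : ℕ) : 𝓞 F)} ∧
      ((Ideal.absNorm w.asIdeal : ℕ) : 𝓞 F) ∈ ∏ g ∈ Ψ, (g • w).asIdeal := by
  classical
  obtain ⟨h4, h5, h6⟩ := dvd_of_prod_univ_eq Ψ w hD (prod_univ_smul_asIdeal_eq_span_absNorm w)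
  rw [card_filter_smul_eq_eq_card_univ_filter Ψ w hD] at h4 h5
  refine ⟨∏ g ∈ Ψ.filter (fun g => g • w ≠ w), (g • w).asIdeal, prod_filter_ne_sup_asIdeal_eq_top Ψ w,
    prod_filter_ne_sup_smul_asIdeal_eq_top Ψ w c hD hc, ?_, h4, h5, h6 (Ideal.mem_span_singleton_self _)⟩
  rw [← card_filter_smul_eq_eq_card_univ_filter Ψ w hD]
  convert prod_smul_asIdeal_eq_pow_mul Ψ w using 2

/-- **The same, in the record՚s costume `(IsCMField.complexConj F) • w`** (`F` a CM field, Galois over `ℚ`; `Ψ ∩ c̃Ψ = ∅` for `c̃ :=` the restriction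
of scalars of complex conjugation to `Gal(F∕ℚ)`): the six clauses of `frob₀_twist` verbatim for `twistIdeal γ_σ := ∏_{g ∈ Ψ} 𝔭_{g•w}`,
`d := #Stab(w)`. [cite: Shimura1998, §13.1 Theorem 1 and (7)] [cite: SerreTate1968, §7 Thm. 11 and Cor. 2] -/
theorem exists_frobeniusShape_prod_smul_asIdeal_complexConj [IsCMField F] [IsGalois ℚ F] [DecidableEq (HeightOneSpectrum (𝓞 F))]
    (Ψ : Finset (F ≃ₐ[ℚ] F)) (w : HeightOneSpectrum (𝓞 F)) (hD : ∀ g : F ≃ₐ[ℚ] F, g • w = w → g ∈ Ψ)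
    (hc : ∀ g ∈ Ψ, ((IsCMField.complexConj F).restrictScalars ℚ) * g ∉ Ψ) :
    ∃ (𝔟 : Ideal (𝓞 F)) (d : ℕ),
      𝔟 ⊔ w.asIdeal = ⊤ ∧ 𝔟 ⊔ ((IsCMField.complexConj F) • w).asIdeal = ⊤ ∧
      ∏ g ∈ Ψ, (g • w).asIdeal = w.asIdeal ^ d * 𝔟 ∧
      w.asIdeal ^ d ∣ Ideal.span {((Ideal.absNorm w.asIdeal : ℕ) : 𝓞 F)} ∧
      ¬ w.asIdeal ^ (d + 1) ∣ Ideal.span {((Ideal.absNorm w.asIdeal : ℕ) : 𝓞 F)} ∧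
      ((Ideal.absNorm w.asIdeal : ℕ) : 𝓞 F) ∈ ∏ g ∈ Ψ, (g • w).asIdeal := by
  obtain ⟨𝔟, h1, h2, h3, h4, h5, h6⟩ := exists_frobeniusShape_prod_smul_asIdeal Ψ w ((IsCMField.complexConj F).restrictScalars ℚ) hD hc
  rw [restrictScalars_complexConj_smul_eq] at h2
  exact ⟨𝔟, _, h1, h2, h3, h4, h5, h6⟩

end Literature.NumberTheory.ComplexMultiplication
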